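import Summits.NavierStokesRegularity.NavierStokesRegularity.Theorems.ExtremiserTransienceNearExtremalTransienceExtremiserLiouvilleConstantSpeedExampleGradient
import Literature.Analysis.FluidPDE.ElgindiBlowup
import HarnessLib

/-!
# Crux `ExtremiserTransience.NearExtremalTransience` (stmt-NavierStokesRegularity-21883), line `extremiser_liouville`,
# stub K1b — THE EXPLICIT CONSTANT-SPEED FIELD: positive, finite enstrophy

`--supports stmt-NavierStokesRegularity-21883` (helper).  Author: prover seat `ns-el-k1b` (g4).  Sequel of
`…ConstantSpeedExample{,FarField,GradientTools,Gradient}`.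

* `fderiv_field_zero`: at the origin `Dv(0) = √2 · J` (`J y = (−y₁, y₀, 0)`), hence `curl_field_zero : curl v (0) = (0, 0, 2√2)`;
* `integrable_sq_norm_curl_field`: `‖curl v‖² ∈ L¹` (`‖curl v‖ ≤ 4‖Dv‖ ≤ 296/Q`, `Q⁻² ∈ L¹(ℝ³)`);
* `enstrophy_field_pos`: **`0 < Z = ∫‖curl v‖²`** — the example is non-degenerate in the enstrophy sense (numerically
  `Z ≈ 17.3`).

So in the vocabulary of `stub_noAnalyticExtremal` the example has `M = 1`, `Z > 0`; (`W = ∫‖∇curl v‖² ≈ 49.3 > 0` and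
`D²v ∈ L²` hold numerically and are not formalised; `S = ∫⟪ω, Dv ω⟫ = 0` by the anti-symmetry under the rotation by `π` about
the `x₀`-axis, so the efficiency inequality is what fails — as it must, by `extendedSharp` it can only hold with `S ≠ 0` for an
extremiser).

WHAT THIS IS NOT: not a counterexample to K1b; K1b is NOT proved; nothing here proves NS regularity. [folklore]
-/

noncomputable section

open Set Filter Topology MeasureTheory Metric Function
open scoped ENNReal NNReal Topology InnerProductSpace RealInnerProductSpace ContDiff
open Literature.Analysis.FluidPDE Literature.Analysis

namespace Summit.NavierStokesRegularity.NavierStokesRegularity.Theorems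

-- the problem directory repeats the summit name (`NavierStokesRegularity/NavierStokesRegularity`)
set_option linter.dupNamespace false

namespace ExtremiserLiouville

namespace ConstantSpeedExample

/-- Values of the building blocks at the origin. [folklore] -/
theorem blocks_zero : uu 0 = 0 ∧ bb 0 = 1 ∧ QQ 0 = 1 ∧ NN 0 = 2 ∧ fc 0 = 0 ∧ hc 0 = 0 ∧ gc 0 = Real.sqrt 2 ∧
    hz 0 = 0 ∧ rotGen (0 : EuclideanSpace ℝ (Fin 3)) = 0 := by
  have hu : uu 0 = 0 := by simp [uu]
  have hb : bb 0 = 1 := by simp [bb]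
  have hQ : QQ 0 = 1 := by simp [QQ, hu, hb]
  have hN : NN 0 = 2 := by simp [NN, hu, hb, hQ]
  refine ⟨hu, hb, hQ, hN, by simp [fc, hu], by simp [hc, hu], by simp [gc, hN, hQ], ?_, ?_⟩
  · simp [hz]
  · ext i; fin_cases i <;> simp [rotGen]

/-- **`Dv(0) = √2 · J`.** [folklore] -/
theorem fderiv_field_zero :
    fderiv ℝ field 0 = Real.sqrt 2 • (rotGenL : EuclideanSpace ℝ (Fin 3) →L[ℝ] EuclideanSpace ℝ (Fin 3)) := by
  obtain ⟨hu, hb, hQ, hN, hf, hh, hg, hhz, hJ⟩ := blocks_zero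
  have hDfc : fderiv ℝ fc 0 = 0 := by
    rw [(hasFDerivAt_fc 0).fderiv]; simp [hu]
  have hDhc : fderiv ℝ hc 0 = 0 := by
    rw [(hasFDerivAt_hc 0).fderiv]; simp
  rw [(hasFDerivAt_field 0).fderiv, hf, hg, hhz, hJ, hDhc, hDfc]
  ext v i
  simp

/-- **`curl v (0) = (0, 0, 2√2)`**, in particular `≠ 0`. [folklore] -/
theorem curl_field_zero_apply_two : curl field 0 2 = 2 * Real.sqrt 2 := by
  rw [curl_eq_curlCLM, fderiv_field_zero, curlCLM_apply]
  simp [rotGen]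
  ring

/-- `curl v (0) ≠ 0`. [folklore] -/
theorem curl_field_zero_ne : curl field 0 ≠ 0 := by
  intro h
  have h2 := congrArg (fun w : EuclideanSpace ℝ (Fin 3) => w 2) h
  simp only [curl_field_zero_apply_two, PiLp.zero_apply] at h2
  have : (0 : ℝ) < 2 * Real.sqrt 2 := by positivity
  linarith

/-- `curl v` is continuous. [folklore] -/
theorem continuous_curl_field : Continuous (curl field) := by
  rw [curl_eq_curlCLM_comp]
  exact curlCLM.continuous.comp ((contDiff_field (n := 1)).continuous_fderiv one_ne_zero)

/-- **Finite enstrophy**: `‖curl v‖² ∈ L¹(ℝ³)` (`‖curl v‖ ≤ 4‖Dv‖ ≤ 296/Q`). [folklore] -/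
theorem integrable_sq_norm_curl_field : Integrable (fun x => ‖curl field x‖ ^ 2) volume := by
  have hint : Integrable (fun x : EuclideanSpace ℝ (Fin 3) => (296 : ℝ) ^ 2 * ((1 : ℝ) + ‖x‖ ^ 2) ^ (-(4 : ℝ) / 2))
      volume := by
    refine (integrable_rpow_neg_one_add_norm_sq ?_).const_mul _
    simp [finrank_euclideanSpace]; norm_num
  refine hint.mono' ((continuous_curl_field.norm.pow 2).aestronglyMeasurable) (Eventually.of_forall fun x => ?_)
  have hQ := QQ_pos x
  rw [Real.norm_eq_abs, abs_of_nonneg (sq_nonneg _)]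
  have h1 : ‖curl field x‖ ≤ 296 / QQ x := by
    calc ‖curl field x‖ ≤ 4 * ‖fderiv ℝ field x‖ := norm_curl_le_four_mul field x
      _ ≤ 4 * (74 / QQ x) := by gcongr; exact norm_fderiv_field_le x
      _ = 296 / QQ x := by ring
  have e : ((1 : ℝ) + ‖x‖ ^ 2) ^ (-(4 : ℝ) / 2) = (QQ x ^ 2)⁻¹ := by
    rw [QQ_eq_norm_sq_add_one, show (-(4 : ℝ) / 2) = -(2 : ℝ) by norm_num, Real.rpow_neg (by positivity), add_comm]
    norm_num
  rw [e]
  calc ‖curl field x‖ ^ 2 ≤ (296 / QQ x) ^ 2 := pow_le_pow_left₀ (norm_nonneg _) h1 2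
    _ = 296 ^ 2 * (QQ x ^ 2)⁻¹ := by rw [div_pow]; ring

/-- **Positive enstrophy**: `0 < Z(v) = ∫‖curl v‖²`. [folklore] -/
theorem enstrophy_field_pos : 0 < ∫ x, ‖curl field x‖ ^ 2 := by
  rw [integral_pos_iff_support_of_nonneg_ae (Eventually.of_forall fun x => sq_nonneg _) integrable_sq_norm_curl_field]
  -- the support contains an open neighbourhood of the origin
  have hc : Continuous fun x => ‖curl field x‖ ^ 2 := continuous_curl_field.norm.pow 2
  have h0 : 0 < ‖curl field 0‖ ^ 2 := by
    have := norm_pos_iff.2 curl_field_zero_ne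
    positivity
  have hopen : IsOpen {x : EuclideanSpace ℝ (Fin 3) | 0 < ‖curl field x‖ ^ 2} := isOpen_lt continuous_const hc
  have hsub : {x : EuclideanSpace ℝ (Fin 3) | 0 < ‖curl field x‖ ^ 2} ⊆ support fun x => ‖curl field x‖ ^ 2 :=
    fun x hx => (ne_of_gt hx : ‖curl field x‖ ^ 2 ≠ 0)
  exact lt_of_lt_of_le (hopen.measure_pos volume ⟨0, h0⟩) (measure_mono hsub)

end ConstantSpeedExample

end ExtremiserLiouville

end Summit.NavierStokesRegularity.NavierStokesRegularity.Theorems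

end
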